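import Literature.NumberTheory.EllipticCurves.OrdinaryLocalReductionMapProofs
import Literature.NumberTheory.EllipticCurves.SerreOpenImageOrdinaryInertiaProofs
import HarnessLib

/-!
# Greenberg's Lemma 3.4 at the layer `n = 0` for `E/ℚ` good ordinary at `p`, and
# `Greenberg1999_coinvariantsRank_eq_selmerCorank_rat_holds`

`Proofs` file (theorems only: **no definition and no named fact is introduced**) in topic
`NumberTheory/EllipticCurves`, discharging the named fact
`Literature.NumberTheory.EllipticCurves.Greenberg1999_coinvariantsRank_eq_selmerCorank_rat`
(R. Greenberg, *Iwasawa theory for elliptic curves*, LNM 1716 (1999), Thm. 1.2 with §1 pp. 60,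
65 of the held copy `book:coates1999-arithmetic-theory-elliptic-curves`: for `E/ℚ` with good
ordinary reduction at `p` and the cyclotomic `ℤ_p`-extension, `rank_{ℤ_p} X/TX = corank Sel_{p^∞}(E/ℚ)`).
The tree had reduced it (`IwasawaSelmerControlAwayFromPProofs`,
`Greenberg1999_coinvariantsRank_eq_selmerCorank_rat_of_ordinary_local_finiteness`) to Greenberg's
Lemma 3.4 at the layer `n = 0`: the `p`-power torsion of
`𝒦_{p,0} = ker (H¹(ℚ_p, E) → H¹(ℚ_{p,∞}, E))` is finite (§3, Lemma 3.4, p. 89: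
"`#ker(r_v) = #Ẽ(𝔽_p)(p)²` … finite"). This file proves that finiteness for a globally minimal
`W/ℚ` with `p ∤ Δ_W`, `p ∤ a_p` (`WeierstrassCurve.finite_localTowerKerPrimary_zero_of_ordinary`)
and assembles the fact (`Greenberg1999_coinvariantsRank_eq_selmerCorank_rat_holds`).

## The proof (elementary form of Greenberg's diagram (5), p. 89)

With `A = E(K̄_v)` (`localPoints`), `G = Γ_{ℚ_v}`, `N = H_{v,∞}` and a topological generator `g`
of `G/N` (`ZpExtension.exists_mem_localSubgroup_generate`), the `p`-power torsion of
`ker (H¹(G, A) → H¹(N, A))` is finite by the skeleton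
`ResKernel.finite_primary_subgroupResKer_of_stableSubgroup` (`IwasawaLocalKummerQuotientProofs`)
applied to the kernel `A₁` of the reduction map `red₀ : E(K̄_v) → Ẽ(k̄_v)` of the integral model
`W_ℤ ⊗ 𝒪_w` over the valuation ring of the spectral valuation `w` of `K̄_v`
(`goodReductionHom`, transported along `W_ℤ ⊗ K̄_v = W ⊗ K̄_v`; its properties are collected in
`OrdinaryLocalReductionMapProofs`). Its hypotheses:
(div) `A` is divisible (`nsmul_surjective_of_isAlgClosed`); (div₁), the generators of
`A₁ ∩ A[p^r]` and `red₀(A[p^r]) = Ẽ[p^r]` are the ordinary filtration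
(`OrdinaryReductionKernelTorsionProofs`, from the ordinary point
`exists_zsmul_eq_zero_spectralValuation_le_one`); (tor) `Ẽ(k̄_v)` is torsion (the residue field
of `K̄_v` is algebraic over `𝔽_p`); (fin) and the bound on the constants of (C1) come from an
arithmetic Frobenius `τ ∈ N` fixing `μ_{p^∞}` (`exists_isArithFrobAt_forall_smul_eq`: `ℚ_∞/ℚ` is
totally ramified at `p`) and the finiteness of the reductions fixed by `τ`
(`finite_setOf_reducePoint_smul_frobenius_eq`: "`Ẽ(𝔽_p)` is finite"); (C1) is
`exists_finset_cocycle_reps_of_ordinaryLine` (`OrdinaryLocalKummerCountProofs`) over the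
Teichmüller layers (`exists_layer_forall_val_smul_sub_lt_one`); (C2) is the Kummer point of
`FormalGroupKummerPointProofs` with `N₀` the order of the (finite) image of `E(ℚ_v)` in `Ẽ`.
Finally `𝒦_{v,0}[p^∞]` embeds into that torsion
(`finite_localTowerKerPrimary_zero_of_finite_primary_subgroupResKer`).

## References

* [GreenbergLNM1716] R. Greenberg, *Iwasawa theory for elliptic curves*, LNM 1716 (1999), Thm.
  1.2, §1 pp. 60, 62, 65, §2 Props. 2.1–2.4 (pp. 70–75), §3 Lemmas 3.3–3.5 (pp. 86–90).
* [SilvermanAEC2009] J. H. Silverman, *The Arithmetic of Elliptic Curves*, 2nd ed. (2009),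
  III.8.1, VII.2.1–2.2, VII.3.1, VII.5.1.
* B. Mazur, *Rational points of abelian varieties with values in towers of number fields*,
  Invent. Math. 18 (1972), §6.
-/

noncomputable section

open scoped Classical NNReal AddSubgroup
open NumberField IsDedekindDomain Polynomial

universe u

namespace WeierstrassCurve

open Literature.NumberTheory.EllipticCurves Literature.NumberTheory.GaloisRepresentations Field
  IsDedekindDomain.HeightOneSpectrum Literature.NumberTheory.EllipticCurves.FormalGroupChart
  Literature.NumberTheory.EllipticCurves.ResKernel

variable (W : WeierstrassCurve ℚ) [W.IsGloballyMinimal] [W.IsElliptic] {p : ℕ} [hp : Fact p.Prime]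
  {v : HeightOneSpectrum (𝓞 ℚ)}

/-! ## §1 Lemma 3.4 at the layer `n = 0` -/

set_option maxHeartbeats 3200000 in
/-- **The `p`-power torsion of `ker (H¹(Γ_{ℚ_v}, E(K̄_v)) → H¹(H_{v,∞}, E(K̄_v)))` is finite** for a
globally minimal `W/ℚ` with `p ∤ Δ_W`, `p ∤ a_p` (good ordinary reduction at `v ∋ p`) and the
cyclotomic `ℤ_p`-extension `κ` (`H_{v,∞} = (Γ_{ℚ_v} → Γ_ℚ)⁻¹(ker κ)`): the skeleton
`ResKernel.finite_primary_subgroupResKer_of_stableSubgroup` for `A = E(K̄_v)`, `A₁ = ker red₀`,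
`N = H_{v,∞}`, a topological generator `g` of `Γ_{ℚ_v}/H_{v,∞}`, fed with the inputs of
`OrdinaryLocalReductionMapProofs`, the
Frobenius `τ ∈ H_{v,∞}` fixing `μ_{p^∞}` (`exists_isArithFrobAt_forall_smul_eq`,
`resGal_mem_kerSubgroup_of_forall_smul_rootOfUnity_eq`), the count (C1)
`exists_finset_cocycle_reps_of_ordinaryLine` (`q = p` for `ℚ`) and the Kummer point (C2)
`exists_kummerPoint`. This is Greenberg's Lemma 3.4 (LNM 1716, §3, p. 89: `ker(r_v)` is finite for
`v ∣ p` good ordinary, `κ` cyclotomic) at the layer `n = 0`, on the whole local Galois group.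
[cite: GreenbergLNM1716, §3 Lemma 3.4 (p. 89)] -/
theorem finite_primary_subgroupResKer_localPoints_of_ordinary (hpv : (p : 𝓞 ℚ) ∈ v.asIdeal)
    (hΔ : ¬ (p : ℤ) ∣ minimalDiscriminantInt W) (hord : ¬ (p : ℤ) ∣ W.frobeniusTrace p)
    (κ : ZpExtension ℚ p) (hκ : κ.IsCyclotomic) :
    Finite {x : subgroupResKer (localPoints W (v.adicCompletion ℚ))
      (localSubgroup κ.kerSubgroup (v.adicCompletion ℚ)) // ∃ k : ℕ, p ^ k • x = 0} := by
  -- the spectral valuation, the model, the reduction map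
  obtain ⟨w, hw⟩ := v.exists_spectralValuation
  have hvO : w.Integers w.valuationSubring := Valuation.valuationSubring.integers w
  have hΔu := W.isUnit_Δ_localIntModel hpv hw hΔ
  let red₀ : localPoints W (v.adicCompletion ℚ) →+
      (((integralModelInt W).map (algebraMap ℤ ↥w.valuationSubring)).map
        (IsLocalRing.residue ↥w.valuationSubring)).toAffine.Point :=
    (goodReductionHom _ hvO hΔu).comp
      (Affine.Point.congrEquiv (localIntModel_baseChange W w.valuationSubring).symm).toAddMonoidHom
  have hred₀ : ∀ P : localPoints W (v.adicCompletion ℚ), red₀ P =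
      ((integralModelInt W).map (algebraMap ℤ ↥w.valuationSubring)).reducePoint
        (Affine.Point.congrEquiv (localIntModel_baseChange W w.valuationSubring).symm P) :=
    fun P ↦ rfl
  -- residue characteristic `p`
  have hpO : w ((p : ℕ) : AlgebraicClosure (v.adicCompletion ℚ)) < 1 := by
    have h := spectralValuation_algebraMap_ringOfIntegers_lt_one (v := v) hw hpv
    rwa [map_natCast] at h
  haveI hchar : CharP (IsLocalRing.ResidueField ↥w.valuationSubring) p := by
    refine (CharP.charP_iff_prime_eq_zero hp.out).mpr ?_
    rw [← map_natCast (IsLocalRing.residue ↥w.valuationSubring), IsLocalRing.residue_eq_zero_iff,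
      IsLocalRing.mem_maximalIdeal, mem_nonunits_iff, hvO.isUnit_iff_valuation_eq_one]
    exact fun h ↦ absurd h (ne_of_lt (by simpa using hpO))
  -- the Frobenius fixing `μ_{p^∞}`, inside `H_{v,∞}`
  obtain ⟨𝔐, h𝔐⟩ := v.localPrimesAbove_nonempty
  have hϖ : Irreducible ((p : ℕ) : v.adicCompletionIntegers ℚ) :=
    irreducible_natCast_adicCompletionIntegers_rat hpv
  obtain ⟨τ, hτ, hτfix⟩ := exists_isArithFrobAt_forall_smul_eq hw h𝔐 hpv hϖ
  have hτHi : τ ∈ localSubgroup κ.kerSubgroup (v.adicCompletion ℚ) :=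
    (mem_localSubgroup_iff _ _ τ).mpr (resGal_mem_kerSubgroup_of_forall_smul_rootOfUnity_eq hκ hτfix)
  -- a topological generator of `Γ_{ℚ_v}/H_{v,∞}`
  obtain ⟨g, -, hgen⟩ := ZpExtension.exists_mem_localSubgroup_generate κ (v.adicCompletion ℚ) 0
  have hmem0 : ∀ σ : absoluteGaloisGroup (v.adicCompletion ℚ),
      σ ∈ localSubgroup (κ.layerSubgroup 0) (v.adicCompletion ℚ) := fun σ ↦ by
    rw [mem_localSubgroup_iff, ZpExtension.layerSubgroup_zero]
    exact Subgroup.mem_top _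
  have hgen' : ∀ U : Subgroup (absoluteGaloisGroup (v.adicCompletion ℚ)),
      IsOpen (U : Set (absoluteGaloisGroup (v.adicCompletion ℚ))) →
        localSubgroup κ.kerSubgroup (v.adicCompletion ℚ) ≤ U → g ∈ U → U = ⊤ :=
    fun U hU hHiU hgU ↦ eq_top_iff.mpr fun σ _ ↦ hgen U hU hHiU hgU (hmem0 σ)
  -- the inputs of `OrdinaryLocalReductionMapProofs`
  obtain ⟨hgenr, hsurj, hdiv₁⟩ := W.localRed_ordinary_filtration hΔu red₀ hred₀
    (W.exists_zsmul_eq_zero_localRed_ne_zero hw hΔu red₀ hred₀ hpv hΔ hord)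
  obtain ⟨SF, hSF⟩ := W.exists_finset_localRed_smul_frobenius hw hΔu red₀ hred₀ h𝔐 hτ
  obtain ⟨N₀, hN₀, hN₀red⟩ := W.exists_nsmul_localRed_eq_zero_of_fixed hw hΔu red₀ hred₀ h𝔐 hτ
  have hstab : ∀ (σ : absoluteGaloisGroup (v.adicCompletion ℚ)) (Q : localPoints W (v.adicCompletion ℚ)),
      red₀ Q = 0 → red₀ (σ • Q) = 0 :=
    fun σ Q hQ ↦ (W.localRed_smul_eq_zero_iff hw hΔu red₀ hred₀ σ Q).mpr hQ
  -- (C2): the Kummer point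
  haveI hV : (W.baseChange (AlgebraicClosure (v.adicCompletion ℚ))).IsIntegral w.integer :=
    ⟨⟨(integralModelInt W).map (algebraMap ℤ ↥w.integer),
      W.baseChange_eq_localIntModel_integer_baseChange⟩⟩
  obtain ⟨u₁, hu₁G, hu₁ker, hC2⟩ := exists_kummerPoint hpv hw h𝔐 hϖ W hN₀ fun a ha ↦
    (W.localRed_eq_zero_iff_mem_kernel hΔu red₀ hred₀ _).mp (hN₀red a ha)
  have hu₁ : u₁ ∈ red₀.ker :=
    (AddMonoidHom.mem_ker).mpr ((W.localRed_eq_zero_iff_mem_kernel hΔu red₀ hred₀ u₁).mpr hu₁ker)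
  -- `q = p`
  have hq : Nat.card (IsLocalRing.ResidueField (v.adicCompletionIntegers ℚ)) = p := by
    rw [natCard_residueField_adicCompletionIntegers v,
      Rat.HeightOneSpectrum.primesEquiv_eq_of_natCast_mem v hp.out hpv]
  -- apply the skeleton
  refine ResKernel.finite_primary_subgroupResKer_of_stableSubgroup
    (localSubgroup κ.kerSubgroup (v.adicCompletion ℚ)) g hgen'
    (continuous_smul_localPoints W (v.adicCompletion ℚ)) p red₀.ker
    (fun σ a ha ↦ (AddMonoidHom.mem_ker).mpr (hstab σ a ((AddMonoidHom.mem_ker).mp ha)))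
    (fun a ↦ nsmul_surjective_of_isAlgClosed
      (V := W.baseChange (AlgebraicClosure (v.adicCompletion ℚ))) hp.out.ne_zero a)
    (fun a ha ↦ ?_) (fun a ↦ ?_) ?_ (c₀ := SF.card * SF.card * p) (fun k ↦ ?_) hu₁G hu₁
    (c₁ := p * N₀) (Nat.mul_pos hp.out.pos hN₀) hC2
  · -- (div₁)
    obtain ⟨b, hb, hpb⟩ := hdiv₁ a ((AddMonoidHom.mem_ker).mp ha)
    exact ⟨b, (AddMonoidHom.mem_ker).mpr hb, hpb⟩
  · -- (tor)
    obtain ⟨n, hn, hna⟩ := W.exists_nsmul_localRed_eq_zero hw red₀ a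
    exact ⟨n, hn, (AddMonoidHom.mem_ker).mpr hna⟩
  · -- (fin): representatives of the classes fixed by `H_{v,∞}` (which contains `τ`)
    let lift : (((integralModelInt W).map (algebraMap ℤ ↥w.valuationSubring)).map
        (IsLocalRing.residue ↥w.valuationSubring)).toAffine.Point →
        localPoints W (v.adicCompletion ℚ) := fun s ↦
      if h : ∃ a : localPoints W (v.adicCompletion ℚ), red₀ a = s then h.choose else 0
    refine ⟨SF.image lift, fun a ha ↦ ?_⟩
    have hτa : red₀ (τ • a) = red₀ a := by
      have h := (AddMonoidHom.mem_ker).mp (ha τ hτHi)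
      rwa [map_sub, sub_eq_zero] at h
    have hex : ∃ a' : localPoints W (v.adicCompletion ℚ), red₀ a' = red₀ a := ⟨a, rfl⟩
    refine ⟨lift (red₀ a), Finset.mem_image.mpr ⟨red₀ a, hSF a hτa, rfl⟩, ?_⟩
    rw [AddMonoidHom.mem_ker, map_sub, sub_eq_zero]
    simp only [lift, dif_pos hex]
    exact hex.choose_spec.symm
  · -- (C1)
    obtain ⟨S, hS, hrep⟩ := W.exists_finset_cocycle_reps_of_ordinaryLine hw h𝔐 hpv hϖ red₀ hstab
      hτ hτfix hgenr hsurj SF hSF (W.exists_layer_localRed_smul_eq hw red₀ hred₀ h𝔐) k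
    rw [hq] at hS
    exact ⟨S, hS, fun ψ hψ hψr ↦ hrep ψ hψ fun g' ↦ (AddMonoidHom.mem_ker).mp (hψr g')⟩

/-- **Greenberg's Lemma 3.4 at the layer `n = 0`: `𝒦_{v,0}[p^∞]` is finite for `v ∣ p` of good
ordinary reduction and the cyclotomic `ℤ_p`-extension** (globally minimal `W/ℚ`, `p ∤ Δ_W`,
`p ∤ a_p`): the `p`-power torsion of the local tower kernel
`𝒦_{v,0} = ker (H¹(H_{v,0}, E(K̄_v)) → H¹(H_{v,∞}, E(K̄_v)))` (`localTowerKerPrimary κ ℚ_v 0`)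
embeds into that of the restriction kernel on `Γ_{ℚ_v}`
(`finite_localTowerKerPrimary_zero_of_finite_primary_subgroupResKer`), which is finite
(`finite_primary_subgroupResKer_localPoints_of_ordinary`). Greenberg, LNM 1716, §3, Lemma 3.4
(p. 89). [cite: GreenbergLNM1716, §3 Lemma 3.4 (p. 89)] -/
theorem finite_localTowerKerPrimary_zero_of_ordinary (hpv : (p : 𝓞 ℚ) ∈ v.asIdeal)
    (hΔ : ¬ (p : ℤ) ∣ minimalDiscriminantInt W) (hord : ¬ (p : ℤ) ∣ W.frobeniusTrace p)
    (κ : ZpExtension ℚ p) (hκ : κ.IsCyclotomic) :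
    Finite (W.localTowerKerPrimary κ (v.adicCompletion ℚ) 0) :=
  W.finite_localTowerKerPrimary_zero_of_finite_primary_subgroupResKer κ (v.adicCompletion ℚ)
    (W.finite_primary_subgroupResKer_localPoints_of_ordinary hpv hΔ hord κ hκ)

end WeierstrassCurve

/-! ## §2 The named fact -/

namespace Literature.NumberTheory.EllipticCurves

open IsDedekindDomain

/-- **`Greenberg1999_coinvariantsRank_eq_selmerCorank_rat` holds**: for `E/ℚ` with globally minimal
model `W`, a prime `p` of good ordinary reduction (`W.HasGoodReductionAtPrime p`, `p ∤ a_p`), the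
cyclotomic `ℤ_p`-extension `κ` with topological generator `γ` and any dual datum `D`, `X/TX` is
finitely generated over `ℤ_p` and `rank_{ℤ_p} X/TX = corank_{ℤ_p} Sel_{p^∞}(E/ℚ)`. Proof: by
`finite_and_coinvariantsRank_eq_selmerCorank_of_finite_coker` and Lemma 3.2
(`finite_coker_and_card_le` at `n = 0`) it suffices that `ker g_0` be finite, which by
`finite_kerG_zero_of_finite_localTowerKerPrimary_dvd` (Lemmas 3.3, 3.5 at `n = 0`) reduces to the
finiteness of `𝒦_{v,0}[p^∞]` at the place `v ∣ p`: Lemma 3.4 at `n = 0`,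
`WeierstrassCurve.finite_localTowerKerPrimary_zero_of_ordinary`, with `p ∤ Δ_W` from the tree's
`not_dvd_minimalDiscriminantInt_of_hasGoodReductionAtPrime'` (`SerreOpenImageOrdinaryInertiaProofs`). Greenberg, LNM 1716, Thm. 1.2,
§1 pp. 60, 65, §3 Lemmas 3.2–3.5 (pp. 86–90); Mazur (1972), §6.
[cite: GreenbergLNM1716, Thm 1.2 and §3 Lemma 3.4 (p. 89)] -/
theorem Greenberg1999_coinvariantsRank_eq_selmerCorank_rat_holds :
    Greenberg1999_coinvariantsRank_eq_selmerCorank_rat := by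
  intro W _ _ p _ hgood hord κ γ hκ hγ D
  have hΔ := W.not_dvd_minimalDiscriminantInt_of_hasGoodReductionAtPrime' p hgood
  haveI := W.finite_kerG_zero_of_finite_localTowerKerPrimary_dvd κ fun v hpv ↦
    W.finite_localTowerKerPrimary_zero_of_ordinary hpv hΔ hord κ hκ
  exact W.finite_and_coinvariantsRank_eq_selmerCorank_of_finite_coker hκ hγ D
    (W.finite_coker_and_card_le κ (W.Greenberg1999_layerInvariants_le_range_holds κ) hκ 0).1

end Literature.NumberTheory.EllipticCurves
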